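import Summits.HodgeConjecture.HodgeConjecture.Theorems.CyclicUnitaryPowersFiniteIndexMonodromyDeckCommutators
import Summits.HodgeConjecture.HodgeConjecture.Theorems.CyclicUnitaryPowersCyclicSurfacePowersHodgeOffMeagre
import Literature.AlgebraicGeometry.HodgeTheory.HodgeFramesBaseChange
import Literature.AlgebraicGeometry.HodgeTheory.HodgeLociCountableOverCurves
import Literature.AlgebraicGeometry.HodgeTheory.HypersurfaceFamilyTopFormFramesChart
import Literature.AlgebraicGeometry.HodgeTheory.AlgebraicMonodromyMumfordTateOfQuasiProjective
import Literature.AlgebraicGeometry.HodgeTheory.HodgeGenericQbarDescentFiniteMonodromyInputs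
import Literature.AlgebraicGeometry.Motives.MumfordTateGroupTransport
import HarnessLib

/-!
# Route CyclicUnitaryPowers — along every algebraic CURVE of `p`-cyclic surfaces with LARGE MONODROMY, the Hodge
# conjecture holds on all powers of ALL BUT COUNTABLY MANY members (CDK-free ALGEBRAIC very-generality in dimension one)

Support file for `stmt-HodgeConjecture-19544` (`--supports`; nothing here closes an item). Prover seat
`hodge-nonav-prover-Ax` (g13, cell hodge-nonav): the assembly of programme «PENCIL» (memo
HOME/memos/PROGRAMME-AE-PENCIL-Ax-g13.md §2), variant with the large-monodromy hypothesis EXPLICIT.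

Setting: `p ≥ 7` prime; `u = cyclicCoverFamily p : 𝒴 ⟶ S` the Carlson–Toledo family; a smooth irreducible quasi-projective
CURVE `P` (`SmoothOfRelativeDimension 1`) with a morphism `ι : P ⟶ S` — an algebraic one-parameter family of smooth
`p`-cyclic surfaces `π' = 𝒴 ×_S P ⟶ P`. HYPOTHESIS (HL, «large monodromy of the curve»): at every point `c ∈ P(ℂ)`, some
finite-index subgroup `Γ₀` of the monodromy group `Γ_{ι c}` of the Carlson–Toledo family consists of (conjugates, through the
fibre identification `e_c : 𝒴'_c ≅ 𝒴_{ι c}`) of monodromies of `π'` at `c` — e.g. `Γ₀ = Γ_{ι c}` for a generic line by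
Zariski's theorem on fundamental groups of hypersurface complements (NOT in the tree; the hypothesis is kept explicit).
CONCLUSION (`hodgeConjectureFor_powers_offCountable_of_curve`): there is a COUNTABLE set `C ⊆ P(ℂ)` such that for every
`c ∉ C`, every smooth projective `X ⊂ ℙ³` cut out by `x₃^p − f_{ι c}` (`f_{ι c}` the ternary form of the point `ι c`) and every
self fibre power `Y = X^{k+1}` satisfy `HodgeConjectureFor (2(k+1)) Y`.

Chain (all tree theorems, no named fact): Griffiths' frames for `u` in algebraic charts
(`exists_topFormFrame_familySpz_chartAt`) PULL BACK to `π'` (`exists_frames_familyPullback_chartAt`); over the curve `P` the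
non-Hodge-generic points of `π'` are COUNTABLE (`exists_countable_isHodgeGenericPoint_of_weightTwoFrames_curve`); at a
`π'`-generic `c` Deligne's lemma (`deligne_finiteIndex_monodromy_le_mumfordTateGroup_of_isQuasiProjectiveOver`, for `π'`)
puts a finite-index subgroup of `Γ_{π'}(c)` inside `MT`; conjugating by `e_c` (transports: `FiberClass.baseChange_transportFun…`;
Mumford–Tate groups: `mem_mumfordTateGroup_comapEquiv_iff`, `hodge_eq_comapEquiv_of_iso`) and intersecting with `Γ₀` gives a
finite-index subgroup of `Γ_{ι c}` inside `MT(H²(𝒴_{ι c}))`, which is exactly the hypothesis of the per-point core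
`hodgeConjectureFor_powers_of_finiteIndex_le_mumfordTate` (PENCIL-1).

HONEST FRAMING: CONDITIONAL on (HL), an explicit hypothesis about the curve (no curve is shown here to satisfy it); the
exceptional set is countable but unspecified; items 19544 ∕ 19543 stay OPEN (CDK floor); rung F-H1 not moved; nothing here
says HC ∕ HC_CM ∕ HC_AV is proved.

## References
* [Deligne1972WeilK3] P. Deligne, La conjecture de Weil pour les surfaces K3, Invent. Math. 15 (1972), Prop. 7.5.
* [CarlsonMullerStachPeters2017] J. Carlson, S. Müller-Stach, C. Peters, Period Mappings and Period Domains, 2nd ed.,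
  Lemma–Def. 15.3.7.
* [CarlsonToledo1999] J. A. Carlson, D. Toledo, Duke Math. J. 97 (1999), §7 Theorem 7.1.
* [VoisinHodgeI2002] C. Voisin, Hodge Theory and Complex Algebraic Geometry I, §9.2.1, §10.2.1.
* [Zariski1937] O. Zariski, A theorem on the Poincaré group of an algebraic hypersurface, Ann. of Math. 38 (1937) — the source
  of (HL) for generic pencils (not used, not typed).
-/

noncomputable section

set_option linter.dupNamespace false

namespace Summit.HodgeConjecture.HodgeConjecture.Theorems.CyclicUnitaryPowersGenericCyclicSurfacePowersHodge

open scoped TensorProduct Topology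
open CategoryTheory CategoryTheory.Limits AlgebraicGeometry
open _root_.Topology _root_.Filter
open Literature.NumberTheory.Transcendental Literature.AlgebraicGeometry.Motives Literature.AlgebraicGeometry.HodgeTheory
open Literature.AlgebraicGeometry.HodgeTheory.BettiUniverse
open Literature.AlgebraicGeometry.Motives.UniversalHypersurface Literature.AlgebraicGeometry.HodgeTheory.UniversalHypersurface
open Literature.AlgebraicTopology.SingularHomology
open Summit.HodgeConjecture.HodgeConjecture.Theorems.CyclicUnitaryPowersHodgeGenericDeckCommutators
open Summit.HodgeConjecture.HodgeConjecture.Theorems.CyclicUnitaryPowersNodalMeridianMonodromy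
open Summit.HodgeConjecture.HodgeConjecture.Theorems.CyclicUnitaryPowersFiniteIndexMonodromyDeckCommutators

/-- The ternary form of degree `p` of a point of the Carlson–Toledo base is non-zero (its cyclic cover form is
nonsingular, `range_coeffChart`, and `x₃^p` is singular for `p ≥ 2`, `isNonsingularForm_cyclicCoverForm_iff`). -/
theorem sum_monomial_coeff_branchForm_ne_zero (p : ℕ) [NeZero p] (hp : 2 ≤ p) (t : ComplexPoints (cyclicCoverBase p)) :
    (∑ e : TernaryIndex p, MvPolynomial.monomial e.1 ((branchForm p t).coeff e.1)) ≠ 0 := by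
  intro h0
  have hmem : (fun e : TernaryIndex p => (branchForm p t).coeff e.1) ∈
      Set.range (fun t : ComplexPoints (cyclicCoverBase p) => fun e : TernaryIndex p => (branchForm p t).coeff e.1) :=
    ⟨t, rfl⟩
  rw [range_coeffChart] at hmem
  have hns : SmoothHypersurface.IsNonsingularForm ℂ
      (∑ e : TernaryIndex p, MvPolynomial.monomial e.1 ((branchForm p t).coeff e.1)) :=
    (isNonsingularForm_cyclicCoverForm_iff hp).1 hmem
  rw [h0] at hns
  obtain ⟨j, hj⟩ := hns.exists_eval_pderiv_ne_zero (z := fun _ => (1 : ℂ))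
    (fun h => one_ne_zero (congrFun h 0)) (by simp)
  simp at hj

/-- **Along an algebraic curve of `p`-cyclic surfaces with large monodromy, the Hodge conjecture holds on all powers of all
but countably many members** (see the module docstring for the setting, the hypothesis (HL) and the chain).
[cite: Deligne1972WeilK3, Prop. 7.5] [cite: CarlsonMullerStachPeters2017, Lemma–Definition 15.3.7]
[cite: CarlsonToledo1999, §7 Theorem 7.1] [cite: VoisinHodgeI2002, §9.2.1 and §10.2.1] -/
theorem hodgeConjectureFor_powers_offCountable_of_curve {p : ℕ} (hp : p.Prime) (h7 : 7 ≤ p)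
    {P : SchemeOver ℂ} (hPq : IsQuasiProjectiveOver P) [AlgebraicGeometry.SmoothOfRelativeDimension 1 P.hom]
    [IrreducibleSpace P.left]
    (ι : haveI : NeZero p := ⟨hp.ne_zero⟩; P ⟶ cyclicCoverBase p)
    (HL : haveI : NeZero p := ⟨hp.ne_zero⟩
      haveI : AlgebraicGeometry.Smooth P.hom := AlgebraicGeometry.SmoothOfRelativeDimension.smooth 1 _
      letI hU := cyclicCoverFamily_locallyTrivial p
      letI hf' := (isSmoothProjectiveFamily_cyclicCoverFamily p).familyPullback_snd ι
      letI hU' := isCohomologicallyLocallyTrivialOn_univ_of_isQuasiProjectiveOver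
        (familyPullback.snd (cyclicCoverFamily p) ι) hf' hPq inferInstance
      ∀ c : ComplexPoints P,
        ∃ Γ₀ : Subgroup (bettiCohomology (fiberOver (cyclicCoverFamily p) (AlgPoints.map ι c)) 2 ≃ₗ[ℚ]
            bettiCohomology (fiberOver (cyclicCoverFamily p) (AlgPoints.map ι c)) 2),
          Γ₀ ≤ ratMonodromyGroup (cyclicCoverFamily p) 2 hU ⟨AlgPoints.map ι c, Set.mem_univ _⟩ ∧
          (Γ₀.subgroupOf (ratMonodromyGroup (cyclicCoverFamily p) 2 hU ⟨AlgPoints.map ι c, Set.mem_univ _⟩)).FiniteIndex ∧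
          ∀ T ∈ Γ₀, (pullEquiv (fiberOverFamilyPullbackIso (cyclicCoverFamily p) ι c) 2).trans
              (T.trans (pullEquiv (fiberOverFamilyPullbackIso (cyclicCoverFamily p) ι c) 2).symm) ∈
            ratMonodromyGroup (familyPullback.snd (cyclicCoverFamily p) ι) 2 hU' ⟨c, Set.mem_univ _⟩) :
    haveI : NeZero p := ⟨hp.ne_zero⟩
    ∃ C : Set (ComplexPoints P), C.Countable ∧ ∀ c : ComplexPoints P, c ∉ C →
      ∀ ⦃X : SchemeOver ℂ⦄, IsSmoothProjective 2 X →
        IsHypersurfaceCutOutBy 3 (MvPolynomial.X (Fin.last 3) ^ p - MvPolynomial.rename Fin.castSucc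
          (∑ e : TernaryIndex p, MvPolynomial.monomial e.1 ((branchForm p (AlgPoints.map ι c)).coeff e.1))) X →
        ∀ ⦃k : ℕ⦄ ⦃Y : SchemeOver ℂ⦄, (∃ π : Fin (k + 1) → (Y ⟶ X), Nonempty (IsLimit (Fan.mk Y π))) →
          HodgeConjectureFor (2 * (k + 1)) Y := by
  haveI : NeZero p := ⟨hp.ne_zero⟩
  haveI hPs : AlgebraicGeometry.Smooth P.hom := AlgebraicGeometry.SmoothOfRelativeDimension.smooth 1 _
  haveI : AlgebraicGeometry.LocallyOfFiniteType P.hom := hPq.locallyOfFiniteType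
  haveI : AlgebraicGeometry.IsSeparated P.hom := hPq.isVarietyPair_ofScheme.isSeparated
  haveI : HodgeTensorFacts.{0, 0} := hodgeTensorFacts_holds
  have hp2 : 2 ≤ p := by omega
  -- ### the two families
  haveI := smoothOfRelativeDimension_baseSpz_hom ℂ 2 p (cyclicCoverSpz p)
  haveI : AlgebraicGeometry.LocallyOfFiniteType (cyclicCoverBase p).hom := locallyOfFiniteType_baseSpz_hom ℂ 2 p _
  haveI : AlgebraicGeometry.IsSeparated (cyclicCoverBase p).hom := isSeparated_baseSpz_hom ℂ 2 p _
  have hf := isSmoothProjectiveFamily_cyclicCoverFamily p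
  have hU := cyclicCoverFamily_locallyTrivial p
  have hf' : IsSmoothProjectiveFamily (familyPullback.snd (cyclicCoverFamily p) ι) 2 := hf.familyPullback_snd ι
  have hU' := isCohomologicallyLocallyTrivialOn_univ_of_isQuasiProjectiveOver
    (familyPullback.snd (cyclicCoverFamily p) ι) hf' hPq inferInstance
  haveI : ∀ t : ComplexPoints (cyclicCoverBase p), Module.Finite ℚ (bettiCohomology (fiberOver (cyclicCoverFamily p) t) 2) :=
    fun t => finite (hf.isSmoothProjective t) 2
  haveI : ∀ c : ComplexPoints P,
      Module.Finite ℚ (bettiCohomology (fiberOver (familyPullback.snd (cyclicCoverFamily p) ι) c) 2) :=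
    fun c => finite (hf'.isSmoothProjective c) 2
  -- real (hence Hodge-symmetric) Hodge models of all fibres
  have hAm := fun t : ComplexPoints (cyclicCoverBase p) =>
    exists_isReal_hodgeModel_holds.exists_isHodgeSymmetric (hf.isSmoothProjective t)
  let A : ∀ t : ComplexPoints (cyclicCoverBase p), HodgeModel 2 (fiberOver (cyclicCoverFamily p) t) :=
    fun t => (hAm t).choose
  have hA : ∀ t, (A t).IsHodgeSymmetric := fun t => (hAm t).choose_spec
  have hAm' := fun c : ComplexPoints P =>
    exists_isReal_hodgeModel_holds.exists_isHodgeSymmetric (hf'.isSmoothProjective c)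
  let A' : ∀ c : ComplexPoints P, HodgeModel 2 (fiberOver (familyPullback.snd (cyclicCoverFamily p) ι) c) :=
    fun c => (hAm' c).choose
  have hA' : ∀ c, (A' c).IsHodgeSymmetric := fun c => (hAm' c).choose_spec
  -- ### frames for the pulled-back family (Griffiths residues, pulled back along `ι`)
  have hF2' := exists_frames_familyPullback_chartAt (cyclicCoverFamily p) ι
    (m := 0 + Nat.card (TernaryIndex p)) (m' := 1) 2 2 hf hU hU' A hA A' hA'
    (fun s t₁ N hN T₁ => by
      obtain ⟨W₀, hW₀o, ht₁W₀, hW₀N, hW₀pc, ψ, ⟨hψa, hψs, hψy⟩, hW₀ψ, r₂, w₂, hw₂, hhol⟩ :=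
        exists_topFormFrame_familySpz_chartAt 1 p (cyclicCoverSpz p) (by omega) (0 + Nat.card (TernaryIndex p))
          hf hU A hA s t₁ N hN T₁
      exact ⟨W₀, hW₀o, ht₁W₀, hW₀N, hW₀pc, ψ, ⟨t₁.1, hψa, hψs, hψy⟩, hW₀ψ, r₂, w₂, hw₂, hhol⟩)
  -- ### the countable exceptional set of the curve
  have hε' : ∀ c : ComplexPoints P, IsClosedImmersion
      (fiberι (familyPullback.snd (cyclicCoverFamily p) ι) c ≫
        (familyPullback.fst (cyclicCoverFamily p) ι ≫
          (totalSpzToTotal ℂ 2 p (cyclicCoverSpz p) ≫ toProjectiveSpace ℂ 2 p))).left := by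
    intro c
    have heq : fiberι (familyPullback.snd (cyclicCoverFamily p) ι) c ≫
        (familyPullback.fst (cyclicCoverFamily p) ι ≫ (totalSpzToTotal ℂ 2 p (cyclicCoverSpz p) ≫ toProjectiveSpace ℂ 2 p)) =
        (fiberOverFamilyPullbackIso (cyclicCoverFamily p) ι c).hom ≫
          (fiberι (cyclicCoverFamily p) (AlgPoints.map ι c) ≫
            (totalSpzToTotal ℂ 2 p (cyclicCoverSpz p) ≫ toProjectiveSpace ℂ 2 p)) := by
      rw [← Category.assoc, ← fiberOverFamilyPullbackIso_hom_fiberι, Category.assoc]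
    rw [heq]
    haveI := isClosedImmersion_fiberι_familySpz_toProjectiveSpace ℂ 2 p (cyclicCoverSpz p) (AlgPoints.map ι c)
    change IsClosedImmersion ((fiberOverFamilyPullbackIso (cyclicCoverFamily p) ι c).hom.left ≫
      (fiberι (cyclicCoverFamily p) (AlgPoints.map ι c) ≫
        (totalSpzToTotal ℂ 2 p (cyclicCoverSpz p) ≫ toProjectiveSpace ℂ 2 p)).left)
    infer_instance
  obtain ⟨C, hCc, hgen⟩ := exists_countable_isHodgeGenericPoint_of_weightTwoFrames_curve
    (familyPullback.snd (cyclicCoverFamily p) ι) hf' hPq hU' A' hA' (show 1 ≤ 2 + 1 by norm_num)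
    (familyPullback.fst (cyclicCoverFamily p) ι ≫ (totalSpzToTotal ℂ 2 p (cyclicCoverSpz p) ≫ toProjectiveSpace ℂ 2 p))
    hε' (fun ψ' => ∃ P₀' : ComplexPoints P,
      (∀ t, (ψ' t : Fin 1 → ℂ) = ComplexPoints.algebraicChart P 1 P₀' t.1) ∧
        (∀ t, t ∈ ψ'.source ↔ t.1 ∈ (ComplexPoints.algebraicChart P 1 P₀').source) ∧
        (∀ z, ((ψ'.symm z : (Set.univ : Set (ComplexPoints P))) : ComplexPoints P) =
          (ComplexPoints.algebraicChart P 1 P₀').symm z)) (fun s' t₁' N' hN' T₁' _ => hF2' s' t₁' N' hN' T₁')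
  refine ⟨C, hCc, fun c hc X hX hcut k Y hY => ?_⟩
  -- ### at a point `c ∉ C`: Deligne's lemma for the curve family
  have hgenc := hgen ⟨c, Set.mem_univ _⟩ hc
  obtain ⟨Γ'', hΓ''le, hΓ''fi, hΓ''MT⟩ :=
    (deligne_finiteIndex_monodromy_le_mumfordTateGroup_of_isQuasiProjectiveOver
      (familyPullback.snd (cyclicCoverFamily p) ι) 2 2 hf'
      (isQuasiProjectiveOver_familyPullback_of_isSeparated (cyclicCoverFamily p) ι
        (isQuasiProjectiveOver_totalSpz 2 p (cyclicCoverSpz p) (cyclicCoverSpz_surjective p (NeZero.ne p))) hPq)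
      hPq hPs inferInstance hU' A' hA' ⟨c, Set.mem_univ _⟩ hgenc).1
  -- ### transfer to the Carlson–Toledo fibre over `ι c`
  let eC := fiberOverFamilyPullbackIso (cyclicCoverFamily p) ι c
  let E : bettiCohomology (fiberOver (familyPullback.snd (cyclicCoverFamily p) ι) c) 2 ≃ₗ[ℚ]
      bettiCohomology (fiberOver (cyclicCoverFamily p) (AlgPoints.map ι c)) 2 := pullEquiv eC 2
  obtain ⟨Γ₀, hΓ₀le, hΓ₀fi, hΓ₀mon⟩ := HL c
  -- the conjugation `T ↦ E⁻¹ T E` as a group homomorphism `Aut H²(𝒴_{ι c}) → Aut H²(𝒴'_c)`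
  let conj : (bettiCohomology (fiberOver (cyclicCoverFamily p) (AlgPoints.map ι c)) 2 ≃ₗ[ℚ]
      bettiCohomology (fiberOver (cyclicCoverFamily p) (AlgPoints.map ι c)) 2) →*
      (bettiCohomology (fiberOver (familyPullback.snd (cyclicCoverFamily p) ι) c) 2 ≃ₗ[ℚ]
        bettiCohomology (fiberOver (familyPullback.snd (cyclicCoverFamily p) ι) c) 2) :=
    { toFun := fun T => E.trans (T.trans E.symm)
      map_one' := by
        ext v
        simp [LinearEquiv.one_eq_refl]
      map_mul' := fun T₁ T₂ => by
        ext v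
        simp [LinearEquiv.mul_eq_trans] }
  have hconj : ∀ T, conj T = E.trans (T.trans E.symm) := fun _ => rfl
  -- the finite-index subgroup of `Γ_{ι c}` inside `MT(H²(𝒴_{ι c}))`
  let Γ' : Subgroup (bettiCohomology (fiberOver (cyclicCoverFamily p) (AlgPoints.map ι c)) 2 ≃ₗ[ℚ]
      bettiCohomology (fiberOver (cyclicCoverFamily p) (AlgPoints.map ι c)) 2) := Γ₀ ⊓ Γ''.comap conj
  have hΓ'le : Γ' ≤ ratMonodromyGroup (cyclicCoverFamily p) 2 hU ⟨AlgPoints.map ι c, Set.mem_univ _⟩ :=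
    fun T hT => hΓ₀le (Subgroup.mem_inf.1 hT).1
  have hΓ'fi : (Γ'.subgroupOf
      (ratMonodromyGroup (cyclicCoverFamily p) 2 hU ⟨AlgPoints.map ι c, Set.mem_univ _⟩)).FiniteIndex := by
    -- `Γ₀.map conj ≤ Γ_{π'}(c)`, so `Γ''` has finite index relative to it
    have hmaple : Γ₀.map conj ≤ ratMonodromyGroup (familyPullback.snd (cyclicCoverFamily p) ι) 2 hU'
        ⟨c, Set.mem_univ _⟩ := by
      rintro _ ⟨T, hT, rfl⟩
      exact hΓ₀mon T hT
    have h1 : Γ''.relIndex (Γ₀.map conj) ≠ 0 := fun h0 =>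
      hΓ''fi.index_ne_zero (Subgroup.relIndex_eq_zero_of_le_right hmaple h0)
    have h2 : (Γ''.comap conj).relIndex Γ₀ ≠ 0 := by
      rwa [Subgroup.relIndex_comap]
    have h3 : Γ'.relIndex Γ₀ ≠ 0 := by
      change (Γ₀ ⊓ Γ''.comap conj).relIndex Γ₀ ≠ 0
      rwa [Subgroup.inf_relIndex_left]
    have h4 : Γ₀.relIndex (ratMonodromyGroup (cyclicCoverFamily p) 2 hU ⟨AlgPoints.map ι c, Set.mem_univ _⟩) ≠ 0 :=
      hΓ₀fi.index_ne_zero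
    refine ⟨?_⟩
    change Γ'.relIndex _ ≠ 0
    rw [← Subgroup.relIndex_mul_relIndex Γ' Γ₀
      (ratMonodromyGroup (cyclicCoverFamily p) 2 hU ⟨AlgPoints.map ι c, Set.mem_univ _⟩) inf_le_left hΓ₀le]
    exact mul_ne_zero h3 h4
  have hHS' : (A' c).hodgeStructure (hf'.isSmoothProjective c) (hA' c) 2 =
      ((A (AlgPoints.map ι c)).hodgeStructure (hf.isSmoothProjective (AlgPoints.map ι c))
        (hA (AlgPoints.map ι c)) 2).comapEquiv E := by
    rw [HodgeModel.hodgeStructure_eq_hodge exists_isReal_hodgeModel_holds hodgePQ_independent_of_hodgeModel_holds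
        (hf'.isSmoothProjective c) (A' c) (hA' c) 2,
      HodgeModel.hodgeStructure_eq_hodge exists_isReal_hodgeModel_holds hodgePQ_independent_of_hodgeModel_holds
        (hf.isSmoothProjective (AlgPoints.map ι c)) (A (AlgPoints.map ι c)) (hA (AlgPoints.map ι c)) 2]
    exact hodge_eq_comapEquiv_of_iso exists_isReal_hodgeModel_holds hodgePQ_independent_of_hodgeModel_holds
      (hf'.isSmoothProjective c) (hf.isSmoothProjective (AlgPoints.map ι c)) eC 2
  have hΓ'MT : Γ' ≤ ((A (AlgPoints.map ι c)).hodgeStructure (hf.isSmoothProjective (AlgPoints.map ι c))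
      (hA (AlgPoints.map ι c)) 2).mumfordTateGroup := by
    intro T hT
    have h := hΓ''MT (Subgroup.mem_inf.1 hT).2
    change conj T ∈ ((A' c).hodgeStructure (hf'.isSmoothProjective c) (hA' c) 2).mumfordTateGroup at h
    rw [hconj, hHS', HodgeStructure.mem_mumfordTateGroup_comapEquiv_iff] at h
    have hid : E.symm.trans ((E.trans (T.trans E.symm)).trans E) = T := by
      ext v
      simp
    rwa [hid] at h
  -- ### the per-point core at `ι c = pt f`
  have hfh : (∑ e : TernaryIndex p, MvPolynomial.monomial e.1
      ((branchForm p (AlgPoints.map ι c)).coeff e.1)).IsHomogeneous p := isHomogeneous_sum_monomial p _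
  have hf0 := sum_monomial_coeff_branchForm_ne_zero p hp2 (AlgPoints.map ι c)
  obtain ⟨eX⟩ := hcut.nonempty_iso_hypersurface
  have hXF : IsSmoothProjective 2 (SmoothHypersurface.hypersurface
      (MvPolynomial.X (Fin.last 3) ^ p - MvPolynomial.rename Fin.castSucc
        (∑ e : TernaryIndex p, MvPolynomial.monomial e.1 ((branchForm p (AlgPoints.map ι c)).coeff e.1)))) :=
    hX.of_iso eX
  have hJ : SmoothHypersurface.IsNonsingularForm ℂ (cyclicCoverForm p
      (∑ e : TernaryIndex p, MvPolynomial.monomial e.1 ((branchForm p (AlgPoints.map ι c)).coeff e.1))) :=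
    CyclicCoverFormNonsingular.isNonsingularForm_cyclicCoverForm_of_isSmoothProjective hp2 hfh hf0 hXF
  have hpt : cyclicCoverPoint p
      (∑ e : TernaryIndex p, MvPolynomial.monomial e.1 ((branchForm p (AlgPoints.map ι c)).coeff e.1)) =
      AlgPoints.map ι c :=
    coeffChart_injective p (funext fun e => by
      change (branchForm p (cyclicCoverPoint p _)).coeff e.1 = (branchForm p (AlgPoints.map ι c)).coeff e.1
      rw [coeffChart_cyclicCoverPoint hfh hJ e]
      exact coeff_sum_monomial p _ e)
  -- the Carlson–Toledo structure on the constructed family (from F1‡, proved)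
  have hsys := fun (g : MvPolynomial (Fin 3) ℂ) (hg : g.IsHomogeneous p) (hg0 : g ≠ 0)
      (hXg : IsSmoothProjective 2 (SmoothHypersurface.hypersurface (cyclicCoverForm p g))) =>
    CyclicUnitaryPowersPLPackageOfLocalMonodromyBound.exists_cyclicReflectionSystem_of_localMonodromyBound
      carlsonToledo1999_nodalMeridianLocalMonodromyBound_holds
      EisenbudHarris2016_surface_secondBettiNumber_holds hp h7 hg hg0 hXg
  let 𝔉 : CarlsonToledoFamily p :=
    { Y := cyclicCoverTotal p
      S := cyclicCoverBase p
      u := cyclicCoverFamily p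
      isSmoothProjectiveFamily := isSmoothProjectiveFamily_cyclicCoverFamily p
      isQuasiProjectiveOver := isQuasiProjectiveOver_baseSpz 2 p (cyclicCoverSpz p)
      isQuasiProjectiveOver_total :=
        isQuasiProjectiveOver_totalSpz 2 p (cyclicCoverSpz p) (cyclicCoverSpz_surjective p (NeZero.ne p))
      smooth := smooth_baseSpz_hom ℂ 2 p (cyclicCoverSpz p)
      irreducibleSpace := irreducibleSpace_cyclicCoverBase p
      locallyTrivial := cyclicCoverFamily_locallyTrivial p
      pt := cyclicCoverPoint p
      exists_polynomials := cyclicCoverPoint_exists_polynomials p hp2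
      pt_surjective := cyclicCoverPoint_surjective p hp2
      iso := fun g hg hg0 hXg => (hsys g hg hg0 hXg).choose
      deck := fun g hg hg0 hXg => (hsys g hg hg0 hXg).choose_spec.choose
      pullEquiv_deck := fun g hg hg0 hXg ha x => (hsys g hg hg0 hXg).choose_spec.choose_spec.1 ha x
      system := fun g hg hg0 hXg => ((hsys g hg hg0 hXg).choose_spec.choose_spec.2).some }
  -- generalise over the point to substitute `pt f = ι c`
  have key : ∀ t' : ComplexPoints (cyclicCoverBase p), t' = AlgPoints.map ι c →
      ∃ Γ₁ : Subgroup (bettiCohomology (fiberOver (cyclicCoverFamily p) t') 2 ≃ₗ[ℚ]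
          bettiCohomology (fiberOver (cyclicCoverFamily p) t') 2),
        Γ₁ ≤ ratMonodromyGroup (cyclicCoverFamily p) 2 hU ⟨t', Set.mem_univ _⟩ ∧
        (Γ₁.subgroupOf (ratMonodromyGroup (cyclicCoverFamily p) 2 hU ⟨t', Set.mem_univ _⟩)).FiniteIndex ∧
        Γ₁ ≤ ((A t').hodgeStructure (hf.isSmoothProjective t') (hA t') 2).mumfordTateGroup := by
    rintro t' rfl
    exact ⟨Γ', hΓ'le, hΓ'fi, hΓ'MT⟩
  exact hodgeConjectureFor_powers_of_finiteIndex_le_mumfordTate hp h7 𝔉 _ hfh hf0 hXF A hA (key _ hpt) hX hcut hY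

end Summit.HodgeConjecture.HodgeConjecture.Theorems.CyclicUnitaryPowersGenericCyclicSurfacePowersHodge

end
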